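import Mathlib
import HarnessLib
import HarnessLib.Audit
import Summits.Langlands.Statement
import Literature.NumberTheory.GaloisRepresentations.OrdinaryGaloisRep
import Literature.NumberTheory.Automorphic.CompletedCohomologyHeckeAlgebraGLn
import HarnessLib.Audit.Status.Attr

/-!
Route: SkinnerWilesDefectOne

# Route SkinnerWilesDefectOne — Skinner–Wiles at defect one — pro-modularity of residually reducible
ordinary GL₂ over imaginary quadratic fields via nice primes in Calegari–Geraghty complexes, the
reducible locus pinned by an auxiliary Steinberg place instead of base change

It suffices to show X = `ReducibleOrdinaryModular`: Skinner–Wiles' Theorem A (SkinnerWiles1999 §4.5,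
p. 74) transposed VERBATIM to an
imaginary quadratic field F (Taylor–Wiles defect l₀ = `defectGL 0 1 2` = 1), where no theorem
exists. For p odd and ι : ℚ̄_p ≃ ℂ, every
continuous irreducible ρ : Γ_F → GL₂(ℚ̄_p), unramified almost everywhere, admitting an integral
model ρ₀ over the valuation ring O of ℚ̄_p
that is upper triangular mod 𝔪 (ρ̄^ss = χ̄_a ⊕ χ̄_b, χ̄_a the global sub), and which at every v ∣ p
is p-DISTINGUISHED (χ̄_a|D_v ≠ χ̄_b|D_v)
and ORDINARY OF ONE PARALLEL WEIGHT k ≥ 2 WITH SKINNER–WILES ORIENTATION (in a frame Q: Q⁻¹ρ|D_vQ =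
(θ₁ ∗; 0 θ₂), θ₂^m = 1 and
θ₁^m = ε^{(k-1)m} on inertia, one k for all v ∣ p, and ‖Q₀₀‖ ≤ ‖Q₁₀‖, i.e. the ordinary line reduces
to the GLOBAL QUOTIENT χ̄_b — SW's
type-𝒟 condition, their admissible cocycle split at every v ∣ p; audited against SkinnerWiles1999
pp. 9–12, 74–75 by three refuter
passes), is MODULAR: there is an L-algebraic cuspidal π on GL₂(𝔸_F) with Satake–Frobenius matching
at almost all v
(`Summit.Langlands.SatakeFrobCompatibleAt`, arithmetic Frobenius, det ρ = ψε^{k-1}). X is a SECTOR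
of Fontaine–Mazur (B) for GL₂/F
(strictly weaker than the summit; the rest is the imported complement `SectorComplement`),
non-vacuous (the 11a isogeny class over
ℚ(√−2) with its oriented lattice meets every hypothesis) and printed nowhere (nearest:
SkinnerWiles1999 / Pan2022 / X. Zhang
arXiv:2411.18661, arXiv:2512.21249 totally real; BergerKlosin2009/2011, Akers2025 minimal with
one-dimensional Selmer group;
CaraianiNewton2023 residually irreducible). X = X₁ ∧ X₂ along SW's own seam: X₁ =
`ReducibleOrdinaryProModular` (THE ENGINE, rank 2:
such ρ is p-adically automorphic of some tame level — a continuous ℚ̄_p-point of the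
completed-cohomology Hecke algebra 𝕋(𝒰) of the
Bianchi tower; SW's Main Theorem "ρ is pro-modular" run at defect one) and X₂ =
`ProModularOrdinaryClassical` (THE EXIT, rank 4:
pro-modular + ordinary of parallel regular weight ⇒ classical; SW Prop. 3.7 / Hida control /
Khare–Thorne top-degree exactness);
the ENTRANCE `EisensteinProModularSeed` (rank 3: a level-controlled oriented Eisenstein congruence =
SW step (II), the first nice
prime) feeds the engine through the glue item `ProModularOfEisensteinSeed`.
THE LEVER (what replaces Skinner–Wiles' base change, unavailable here because every extension of F
raises l₀ — CalegariGeraghty2017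
Rem. 5.14). Cuspidal Hida families over F are Λ_F-torsion; over the 5-dimensional Iwasawa algebra
Λ_F every irreducible nearly
ordinary component has dimension ≥ 4 = dim Λ_F − l₀, and SW's chain needs the type-𝒟 reducible locus
in dimension ≤ 3. By
SkinnerWiles1999 Lemma 2.7 that locus is a residual pencil of dimension r₀ + 1 (r₀ = number of
independent admissible residual
extensions) plus Λ-adic strata read off the support of the split Iwasawa–Selmer module H over
𝒪⟦ℤ_p²⟧ (dim = 2 + max_Z(dim Z + r_Z − 1));
without base change a common divisor of the two Katz p-adic L-functions, μ > 0 or a tame Euler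
divisor each yield a 4-dimensional
stratum. The pencil is handled by the REGIME r₀ ≤ 2 (r₀ = 1 — Berger–Klosin uniqueness — for the
witness and for 20 of 21 imaginary
quadratic fields tested, r₀ = 2 for the 21st; unconditional PARI, kit j007870/j008702/j009536), the
Λ-adic strata by ONE AUXILIARY
TAYLOR–STEINBERG PLACE v₀ (N v₀ ≡ 1 mod p, ρ̄(Frob_v₀) = 1, chosen by Čebotarev): on the
Steinberg-shaped locus of the level-S∪{v₀}
ring every REDUCIBLE point satisfies the tame relation Ψ(Frob_v₀) = (N v₀)^{±1} (kernel-checked and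
LANDED:
`SteinbergHyperplane.tame_relation_pin`, `.steinberg_hyperplane` in
Theorems/SkinnerWilesDefectOneReducibleOrdinaryProModularDefs.lean,
p85254) — a moving divisor D_v₀ of Spec 𝒪⟦ℤ_p²⟧ on which the Steinberg shape imposes one further
local equation and whose position
(the direction of Frob_v₀ in ℤ_p²) Čebotarev keeps off the finitely many height-one primes of Supp H
(H torsion: Rubin1991,
deShalit1987); every Λ-adic stratum drops to dimension ≤ 3 from torsion-ness + Čebotarev alone — no
μ = 0, no pseudo-nullity, no base
change — at zero cost to irreducible components; ρ itself (unramified at v₀) is re-entered through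
the level-raising divisor by one
relative patching at a characteristic-0 dimension-one prime in Taylor's Ihara-avoidance window
(Taylor2008; arXiv:1812.09999 §6.2.5).
This is Allen–Newton–Thorne's `locally Steinberg' bound on the reducible locus
(AllenNewtonThorne2020, Thorne2014: native Steinberg
place, polarized, l₀ = 0) made AUXILIARY and run non-polarized at l₀ = 1 inside
Calegari–Geraghty/Hansen two-term complexes with
Scholze2015/CaraianiNewton2023 torsion determinants as the Hecke side. Checked skeleton with the
lead prover:
Cruxes/ReducibleOrdinaryProModular/Lines/steinberg_hyperplane.lean (6 registered stubs;
`ReducibleOrdinaryProModular_of` kernel-checked).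
Lean: `∀ (F : Type) [Field F] [NumberField F], NumberField.IsTotallyComplex F → Module.finrank ℚ F =
2 → ∀ (p : ℕ) [Fact p.Prime], p ≠ 2 → ∀ (O : ValuationSubring (PadicAlgCl p)), O = (Valued.v :
Valuation (PadicAlgCl p) NNReal).valuationSubring → ∀ (hcpt :
Literature.NumberTheory.Automorphic.isCompact_glFiniteIntegralLevel 2 F) (ι : PadicAlgCl p ≃+* ℂ) (ρ
: Literature.NumberTheory.GaloisRepresentations.FramedGaloisRep F (PadicAlgCl p) 2) (ρ₀ :
Field.absoluteGaloisGroup F →* Matrix.GeneralLinearGroup (Fin 2) O), ρ.toGaloisRep.IsIrreducible →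
(∀ᶠ v in cofinite, ρ.IsUnramifiedAt v) → ρ.HasUpperTriangularIntegralModel ρ₀ → (∃ k : ℕ, 2 ≤ k ∧ ∃
m : ℕ, 0 < m ∧ ∀ v : IsDedekindDomain.HeightOneSpectrum (NumberField.RingOfIntegers F), (p :
NumberField.RingOfIntegers F) ∈ v.asIdeal →
Literature.NumberTheory.GaloisRepresentations.IsPDistinguishedAt ρ₀ v ∧ ∃ Q :
Matrix.GeneralLinearGroup (Fin 2) (PadicAlgCl p), Valued.v (Q.val 0 0) ≤ Valued.v (Q.val 1 0) ∧ ∀ σ,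
(Q⁻¹ * ρ.toLocal v σ * Q).val 1 0 = 0 ∧ (σ ∈
Literature.NumberTheory.GaloisRepresentations.absInertia (v.adicCompletion F) → (Q⁻¹ * ρ.toLocal v σ
* Q).val 1 1 ^ m = 1 ∧ (Q⁻¹ * ρ.toLocal v σ * Q).val 0 0 ^ m = algebraMap (Padic p) (PadicAlgCl p)
(((Literature.NumberTheory.GaloisRepresentations.GaloisRep.cyclotomicCharacter (v.adicCompletion F)
p σ).val : PadicInt p) : Padic p) ^ ((k - 1) * m))) → ∃ π :
Literature.NumberTheory.Automorphic.CuspidalAutomorphicRepData 2 F hcpt, π.1.IsLAlgebraic ∧ ∀ᶠ v in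
cofinite, Summit.Langlands.SatakeFrobCompatibleAt ι π.1 ρ v`

## Assembly
Pure logic given the items, and LANDED: `ModularOfProModularClassical : ReducibleOrdinaryProModular
→ ProModularOrdinaryClassical →
ReducibleOrdinaryModular` (engine → exit → X; PROVED,
Theorems/SkinnerWilesDefectOneModularOfProModularClassical.lean, p83517: under X's
binders the engine gives 𝒰 with `𝒰.IsPadicallyAutomorphic ρ`, the local clause minus
distinguishedness/orientation gives
`ρ.IsOrdinaryOfWeightAt p v k m` by `FramedGaloisRep.isOrdinaryOfWeightAt_iff_padicAlgCl`, the exit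
gives π), the item `Assembly`
(PROVED, commit 4d19212e9a4d) and the deciding theorem `closes : ReducibleOrdinaryProModular →
ProModularOrdinaryClassical →
SectorComplement → Langlands` (native OK; it inlines the same 8-line term and hands X to the
imported complement). The seed reaches the
summit through items: `ProModularOfEisensteinSeed : EisensteinProModularSeed →
ReducibleOrdinaryProModular` (glue = SW steps (I)+(III)
given (II), open), then `closes`. The headline `FiveIsogenyEllipticCurves` is a corollary of X
(support; a dozen helper files on its
frames / adapted basis / ordinary line / local clause / irreducibility / Satake already accepted)
and is not a hypothesis of `closes`.

Rationale: WHY THIS LINE. (1) THE GAP. Every positive-defect automorphy lifting theorem over CM fields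
(ACCGHLNSTT2023; CaraianiNewton2023 =
arXiv:2301.10509) needs ρ̄ with enormous / decomposed-generic image; every residually reducible
theorem is defect zero
(SkinnerWiles1999 totally real; Pan2022; X. Zhang arXiv:2411.18661, arXiv:2512.21249 — SW nice
primes married to completed
cohomology, totally real; Thorne2014 / AllenNewtonThorne2020 polarized) or minimal with a
one-dimensional Selmer group
(BergerKlosin2009, BergerKlosin2011, Akers2025 — no Taylor–Wiles primes at all). X sits exactly in
the hole: GL₂ over an
imaginary quadratic F, ρ̄ reducible, non-polarizable, l₀ = 1 (zbMATH/arXiv/galaxy re-searched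
2026-08-16: nothing new).
(2) THE MECHANISM = Skinner–Wiles' three steps with the two defect-one substitutions made explicit.
(a) "Hida families
over imaginary quadratic fields have the wrong dimension" is the DEFINITION of the arena, not a
surprise: cuspidal
nearly ordinary Hida families over F are Λ_F-torsion (Hida1993Duke; CalegariMazur2008 §1), Λ_F =
𝒪⟦T₁,T₂,Y₁,Y₂⟧ of
Krull dimension 5, so "large component" means dimension ≥ dim Λ_F − l₀ = 4 (the Galois
Euler-characteristic presentation of
R_𝒟 gives ≥ 4 for every component through an irreducible point — the nearly ordinary shadow of the
big-R = 𝕋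
dimension formula 1 + dim B − l₀ of GeeNewton2020, which predicts equality), and the patching that
feeds SW step (I) is the positive-defect kind built for 𝒪-torsion Hecke modules —
Calegari–Geraghty/Hansen two-term complexes in degrees [q₀, q₀+1] (CalegariGeraghty2017 §§5, 8;
Hansen2012 Thm. 1.1,
conditional there on his Conj. 3.1 = existence + local–global compatibility of torsion Galois
representations, which
Scholze2015 (existence) and the ordinary local–global compatibility of arXiv:1812.09999 /
CaraianiNewton2023 Thm. 4.2.15 supply
for non-Eisenstein decomposed-generic 𝔪 over CM fields F′ with [F′⁺ : ℚ] > 1 — hence the quadratic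
ascent of (4);
KhareThorne2017 §6 for the ordinary Λ-adic complexes) run over the one-dimensional base R_𝒟/𝔭 at a
NICE prime 𝔭, where ρ_𝔭 IS
absolutely irreducible. The numerology has margin exactly one — components ≥ 4 versus reducible
locus ≤ 3 — as in SW
over ℚ (3 versus 2). (b) "Nice-prime existence may fail in defect one": SW manufacture the margin by
cyclotomic base
change (Washington), which shrinks the reducible locus relative to dim Λ; here every extension of F
raises l₀
(CalegariGeraghty2017 Rem. 5.14; in the CM direction the margin 3 − r₀ is base-change invariant), so
the bound must hold
over F itself. By SkinnerWiles1999 Lemma 2.7 the type-𝒟 reducible locus is a residual pencil of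
dimension r₀ + 1 plus
Λ-adic strata of dimension 2 + (dim Z + r_Z − 1) over the support strata Z of the split
Iwasawa–Selmer module H of
Ψ = χ_a/χ_b over Λ_Ψ = 𝒪⟦Gal(F̃_∞/F)⟧ ≅ 𝒪⟦ℤ_p²⟧ (triage K1, three independent derivations). THE NEW
LEVER (crux chain
2026-08-16, lead prover seated on it): one AUXILIARY TAYLOR–STEINBERG PLACE v₀ ∤ p (ρ unramified at
v₀, N v₀ ≡ 1 mod p,
ρ̄(Frob_v₀) = 1: arXiv:1812.09999 §6.2.5 verbatim), chosen by Čebotarev off a thin set. On the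
Steinberg-shaped locus of the
nearly ordinary ring at level S ∪ {v₀} the tame relation forces every REDUCIBLE point onto the
moving divisor
D_v₀ = {Ψ(Frob_v₀) = (N v₀)^{±1}} ⊂ Spec Λ_Ψ (kernel-checked, LANDED p85254:
`SteinbergHyperplane.tame_relation_pin`,
`.steinberg_hyperplane`; q(a+d)² − (1+q)²ad = (qa−d)(a−qd)), the Steinberg shape adds one local
equation on D_v₀, and the
DIRECTION of Frob_v₀ in ℤ_p² keeps D_v₀ off the finitely many height-one primes of Supp H (H is
Λ_Ψ-torsion: Rubin1991,
deShalit1987, weak Leopoldt for abelian-over-F fields) — so every Λ-adic stratum has dimension ≤ 3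
from TORSION-NESS +
ČEBOTAREV alone (no μ = 0, no pseudo-nullity / GGC-type coprimality of the Katz pair, no base
change), at zero cost to
the irreducible components (a tame condition away from p). ρ itself is unramified at v₀: it is
re-entered through the
level-raising divisor V(f_v₀) ∩ C_ρ by ONE relative patching at a CHARACTERISTIC-0 dimension-one
prime in Taylor's
Ihara-avoidance window (Taylor2008; the (1,1)/(χ₁,χ₂) comparison of arXiv:1812.09999 §§6.2.5, 6.3).
This is the
`locally Steinberg' control of the reducible locus of AllenNewtonThorne2020 §3 / Thorne2014 — there
with a NATIVE
Steinberg place, polarized, l₀ = 0 — made auxiliary and run non-polarized at l₀ = 1; it is the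
renewable substitute for
SW's base change. (c) The residual pencil is NOT touched by any pin (triage K1/(C5): the Steinberg
conditions are
identities on it), so the mechanism's honest scope is the REGIME r₀ ≤ 2 — which contains every
worked example:
r₀ = 1 (Berger–Klosin uniqueness of the admissible extension) for the witness and for 20 of the 21
imaginary quadratic
fields d ≤ 39 tested with the 11a3-type datum, r₀ = 2 at d = 10 (kit j007870, j008702, j009536;
PARI, bnfcertify = 1,
unconditional); r₀ ≥ 3 data are carried by an honestly-labelled regime stub at big-R = 𝕋 strength.
(3) WHY THIS FORM IS
EASIER than Fontaine–Mazur in the sector: X₁ (pro-modularity) asks only for a point of the completed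
Hecke algebra at
SOME tame level (depth and bad set free — legitimate and necessary by the landed
Negative.LevelAndRamification lemmas),
which is what relative patching at a nice prime outputs; X₂ (classicality) is then a statement about
ONE characteristic-0
point of a CONSTRUCTED ordinary Hecke algebra, attackable by Khare–Thorne's top-degree exact control
with no
torsion-freeness input. (4) IMPORTS (arithmetic, not analogical): two-variable Iwasawa theory of
imaginary quadratic
fields (Rubin1991, Gillard1985), Eisenstein cohomology of Bianchi groups and Berger's Eisenstein
ideal (Harder1987,
Berger2009), level raising (Ribet1976 shape, DiamondTaylor1994, Taylor2008),
Calegari–Geraghty/Hansen/Khare–Thorne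
complexes, Scholze2015/CaraianiNewton2023 torsion determinants, ACC+ ordinary local–global
compatibility after the
quadratic ascent F′ = F·F₁ (triage K5: ACC+ needs [F′⁺:ℚ] > 1 — defect 2, available).

RANKED CRUXES. #0 ReducibleOrdinaryModular (target) — X above (statement audited ×3; true iff
Fontaine–Mazur (B) holds in the sector).
PROVED GLUE: `ModularOfProModularClassical : #2 → #4 → #0` (p83517). [SkinnerWiles1999,
FontaineMazurGeometric1995,
BergerKlosin2009, arXiv:2301.10509, CalegariMazur2008]
#2 ReducibleOrdinaryProModular (crux, rank 2, XL) — THE ENGINE = SW Main Theorem at defect one. Same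
binders/hypotheses as
X minus (hcpt, ι); conclusion ∃ 𝒰 : BigHeckeGLn.TameLevel 2 F p, 𝒰.IsPadicallyAutomorphic ρ (ρ
unramified off 𝒰.bad and
charpoly ρ(Frob_v) = x(X² − T_{v,1}X + q_v T_{v,2}) for a CONTINUOUS x : 𝕋(𝒰) → ℚ̄_p; irreducible ρ
cannot be an
Eisenstein/boundary point). Disprover (Disproof.lean v3, no kill): the crux is the
reducible-ordinary SECTOR of big
R = 𝕋 (`crux_of_proModularity`: every hypothesis but hirr/hunr is method-only); hunr is NECESSARY
(`withoutAEUnramified_iff`); the natural strengthening "level = full" is REFUTED for any ρ ramified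
off p
(`not_isPadicallyAutomorphic_full`, landed p73497 with `exists_isPadicallyAutomorphic_bad_eq`: bad
is upward free).
CHAIN: 7 ideas → 6 pass a 3-refuter triage → 3 checked skeletons → lead PICKED
`steinberg-hyperplane`
(Lines/steinberg_hyperplane.lean; 6 registered stubs, `ReducibleOrdinaryProModular_of`
kernel-checked): S1
chebotarevSupply — PROVED and landed (Theorems/…ChebotarevSupply.lean, 0 sorry: Čebotarev for the
regular Artin
representation of Γ_F/N via the proved `chebotarev_artinRep_holds`); S2 orientedSteinbergDatum —
Ribet end-lattice
selection landed (…OrientedSteinbergDatumRibetAux.lean), Mazur representability of the oriented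
datum from the tree's
`NearlyOrdinaryDeformationRing`; S3 smallReducibleSteinbergLocus — THE HEART (Galois/Iwasawa only;
the lever above;
first Monday lemma = the landed pin); S4 steinbergLevelEngine — SW (II)–(III) + Raynaud inside the
Steinberg locus + (P1)
at nice primes RAMIFIED at v₀ (local ring a domain, no Ihara input); S5 iharaCrossing — HARDEST
(non-minimal (P1) in
positive defect at a characteristic-0 crossing prime; Taylor's door); S6 largeSelmerRegime — r₀ ≥ 3
/ m_{S♯} ≥ 2
complement, honestly labelled, not staffed. Fallback lines (checked, parked):
`fine-selmer-codimension-two` (measure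
R^red by the two-variable main conjecture: Transfer r₀ ≤ 2 ∧ coprime primitive Katz pair ∧ μ = 0 ∧
tame non-vanishing ⇒
SmallReducibleLocus; Hecke-free) and `generic-eisenstein-rigidity` (Berger–Klosin
principality/numerical criterion at the
GENERIC point of an Eisenstein divisor; no patching at all). (why it might fail: see item; sources:
SkinnerWiles1999,
CalegariGeraghty2017, Hansen2012, KhareThorne2017, AllenNewtonThorne2020, Thorne2014, Taylor2008,
Rubin1991,
CalegariMazur2008, Scholze2015, arXiv:2301.10509, arXiv:1812.09999, arXiv:2411.18661) [deps:
EisensteinProModularSeed via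
the glue ProModularOfEisensteinSeed]
#3 EisensteinProModularSeed (crux, rank 3, L) — THE ENTRANCE = SW step (II) level-controlled: same
binders; ∃ tame level 𝒰,
an IRREDUCIBLE r : Γ_F → GL₂(ℚ̄_p) p-adically automorphic of level 𝒰 with an integral model r₀ upper
triangular mod 𝔪
having ρ₀'s ORDERED residual diagonal, r oriented-ordinary of some parallel weight k′ ≥ 2 at every v
∣ p, and ONE auxiliary
place q such that 𝒰 is hyperspecial at every v ≠ q, v ∤ p where both residual characters are
unramified (an Eisenstein
congruence at cond(χ̄_a, χ̄_b)·p^∞·q — not implied by the engine applied to ρ). Disprover: no kill;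
`crux_of_pairSeed`;
Negative/OrientedFrame + BorelAndEisenstein landed (oriented frames are forced by unit-root
congruences; a Borel-shaped r
never witnesses the conclusion, and every witness carries the Eisenstein congruence of the pair at
each Frobenius off bad). CHAIN: lead PICKED `descend-raise-basechange`: on the Billerey–Menares
range (p ≥ 5, ratio descends to
an odd character of Γ_ℚ in the Serre-weight window, Mazur corner excluded) the seed is IMPORTED from
ℚ — level-raised
Eisenstein newform on a modular curve (Ribet1976/DiamondTaylor1994 shape), Langlands quadratic base
change, restriction
and twist (ten helper files accepted: Billerey–Menares prime supply, level-raised newform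
frame/inertia/glue, base-change
twist, restrict-twist Galois package) — so nothing is deformed over F and no Bianchi torsion class
is
lifted; the genuine (non-base-change) residue is ONE registered stub `stub_complementRegimeSeed`,
the docking port for
Berger2009 Thm. 13 (p split, p ∤ h_F·#(𝒪_F/𝔣)^×, H²_c torsion-free, p | L^alg(0, χ_aχ_b⁻¹)) and for
Eisenstein level
raising with torsion Bianchi classes (CalegariVenkatesh2019). Certified positive instance inside the
range: ℚ(√−2),
p = 5, (1, ω), M = 31. [Berger2009, arXiv:math/0701177, BergerKlosin2011, Ribet1976,
DiamondTaylor1994,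
SkinnerWiles1999, Scholze2015, CalegariVenkatesh2019]
#4 ProModularOrdinaryClassical (crux, rank 4, L) — THE EXIT, typed WITHOUT residual hypotheses
(dedups with any GL₂/F
route): F imaginary quadratic, p odd, ρ irreducible, a.e. unramified, p-adically automorphic of some
tame level and
ordinary of ONE parallel weight k ≥ 2 (no orientation) ⇒ ∃ L-algebraic cuspidal π with
Satake–Frobenius matching a.e.
Disprover: crux minus pro-modularity = FM (B) in its sector; no kill. CHAIN: lead PICKED
`top-degree-exact-control`: the
open core is isolated in ONE transfer stub (OF) `stub_ordinaryFactorisation` (Galois-ordinary ⇒ the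
point factors
through Hida's ordinary part — typeable now: the route's definition request
`TameLevel.IsOrdinarilyPadicallyAutomorphic`
/ `OrdinaryHeckeAlgebraGLn` LANDED in Literature/…/OrdinaryCompletedCohomologyGL.lean, with
`HasDominantDiamondWeight`
in BianchiOrdinaryClassicality.lean); the rest is Hecke-side over CONSTRUCTED objects:
diamond-weight bookkeeping
(central weight file accepted; the naive slot-zero stub was shown FALSE modulo a companion-point
hypothesis by the
disprover — NegativeNotes slotZeroDiamondWeight — and is being recut as
`dominantOfCentralAndSlotZero`), Khare–Thorne
top-degree exact control + Nakayama at a characteristic-0 prime (KhareThorne2017 Prop. 6.6, Cor.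
6.8, 6.15, valid over
any number field) and the Franke/Harder dictionary to π (`hasSatakeParamAt_iff_L2_eventually`,
`exists_cuspidalRepData_of_L2_holds`, both proved). (OF) is where ModPLanglandsGL2BeyondQp is
skirted: only Hida theory
and ordinary deformation theory at v ∣ p, never a p-adic local correspondence; for inert p the
converse direction
(automorphic ⇒ Galois-ordinary) is AHTW2026/CaraianiNewton2023, the needed direction is the bet.
[Hida1993Duke,
Hida1994AIF, KhareThorne2017, SkinnerWiles1999, Emerton2011LocalGlobal, arXiv:2301.10509, AHTW2026,
Harder1987]
#9 SectorComplement (crux by kind only — IMPORTED COMPLEMENT `ReducibleOrdinaryModular → Langlands`,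
trivially implied by
the summit, never staffed, never glue; present so that `closes` ends in the summit constant by name,
the convention of
CapacityClassicality / TriangulineChamber / GaloisWeightedBE). Judge the route on #2/#3/#4/#0.
[BuzzardGeeLMS2014,
FontaineMazurGeometric1995, Calegari2023]
SUPPORTS (rank 9, do not drive staffing): ModularOfProModularClassical (#2 → #4 → #0, PROVED
p83517); Assembly (PROVED);
ProModularOfEisensteinSeed (#3 → #2 = SW (I)+(III) given (II); its two formal edges landed, content
= the engine's S3–S5);
FiveIsogenyEllipticCurves (HEADLINE COROLLARY of X: E/F non-CM with an F-rational 5-isogeny of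
UNIFORM type above 5 and
good ordinary reduction at v ∣ 5 is modular in the lang.S28 shape — a dozen helper files on frames /
adapted basis /
ordinary line & vector / local clause / inertia / irreducibility / Satake accepted, assembly of the
corollary pending;
the members NOT already covered by CaraianiNewton2023's 3–5 switching are the curves whose mod-3
representation is also
small, e.g. non-CM points of X₀(15)(F), infinitely many iff rk X₀(15)(F) > 0).

TWO-LAYER PLAN. Layer 2 now EXISTS as registered stubs, not items (D-0019: lemmas ride with
`--supports`): engine = S1–S6 of
`steinberg-hyperplane` (S1 proved; S2 in progress; S3 heart; S4/S5 the defect-one patching debt; S6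
regime); exit = (OF) +
diamond weight + dominant-points-classical + Satake dictionary of `top-degree-exact-control`; seed =
five theorem-grade
stubs + `stub_complementRegimeSeed` of `descend-raise-basechange`. The ONE item-level split this
planner pre-announces
for tenure (to be installed when the lead hands back S6, or at once if falsifier (1) below fires):
ReducibleOrdinaryProModular ⇐ ReducibleOrdinaryProModularSmallRank (the engine under
`UniqueAdmissibleExtension ρ ρ₀` /
r₀ ≤ 2, typed over the lead's vocabulary `ModelData`, `Models`, `baseLevel`, `ClosedPointStratumLE`
once it is hoisted out
of the Theorems-side Defs file — which imports the route file — into an importable Defs module: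
definition request (3))
+ LargeRankRegime (r₀ ≥ 3 ⇒ engine; big-R = 𝕋 strength, crux-labelled, not
staffed) with glue by cases — an ADDITION beside the engine (never a rewording: the lead's `_of`
composition and the
landed `crux_iff` are typed against the current signature). Exit split foreseen:
ProModularOrdinaryClassical ⇐
OrdinaryFactorisation (typeable now via `IsOrdinarilyPadicallyAutomorphic`) → HidaControlGL2F.

KILL CRITERIA. TRUTH KILLS (close the route `refuted:<Decl>` after the typing check — normalisation,
orientation inequality,
TameLevel junk, all three already audited): a counterexample to #0 or #4 as typed = a failure of
Fontaine–Mazur (B) in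
the sector; a residual pair of an admissible ρ with NO level-controlled irreducible ordinary
pro-modular lift refutes #3
but only forces SW's full step (II) with a finite set of level-raising places (restate, class
misstated). MECHANISM
KILLS (each cheap, each informative): (K-a) r₀ ≥ 3 for the generic member of a target population
(first test: a
NON-base-change uniform 5-isogeny curve over the first F with rk X₀(15)(F) > 0) ⇒ that population
leaves the mechanism
(residual pencil of dimension ≥ 4, triage K1) and the engine is re-filed as the SmallRank/LargeRank
pair above — the
line survives on r₀ ≤ 2, the claim shrinks honestly; (K-b) a witness datum for which EVERY
Taylor–Steinberg direction
meets a height-one prime of Supp H (the avoided set is not thin — e.g. H supported on all of a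
ℤ_p-line of characters)
kills S3 and with it both Steinberg lines ⇒ fall back to `fine-selmer-codimension-two`, whose
transfer needs the OPEN
coprimality of the primitive Katz p-adic L-functions (one-sided main conjectures give only the upper
bound) — the route
would then be openly conditional on a GGC-type statement and should be re-tiered; (K-c) S5: if
Taylor's Ihara avoidance
cannot be run at a non-classical characteristic-0 point of a residually reducible family
(arXiv:1812.09999 §6.3.2
hard-wiring non-Eisenstein 𝔪) AND Eisenstein level raising for torsion Bianchi classes fails
(CalegariVenkatesh2019
ties torsion level-lowering to K₂), the crossing is dead: PatchingLocalComponentBarrier wins at ℓ =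
v₀ and the engine
keeps only S4's interior patching — pro-modularity of the Steinberg-shaped primes of the
level-raised ring, not of ρ; (K-d) Hecke side: for isogeny
characters with θ² ∈ {1, ω²} (the rational-5-torsion sub-population, including the 11a witness)
decomposed genericity
fails under every twist (kernel-checked ZMod 5 census, triage K7), so no torsion local–global
compatibility is available
even over F′ = F·F₁; that sub-population waits on Eisenstein-localised LGC (card
eisenstein-lgc-at-nice-prime) while
θ² ∉ {1, ω²} is attackable now — a proof that Eisenstein-localised torsion LGC is unreachable would
cut the headline to
θ² ∉ {1, ω²}. MOOT IF PROVED ELSEWHERE: a residually reducible positive-defect lifting theorem over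
CM fields (none;
watch X. Zhang's programme arXiv:2512.21249 moving from totally real to CM, and AHTW2026-type LGC at
Eisenstein 𝔪).

NOT DECOMPOSED YET. Deliberately not filed as items: the stubs above (they are the lead provers'
registered skeletons); the
SmallRank/LargeRank re-filing of the engine (pre-announced, tenure); OrdinaryFactorisation /
HidaControlGL2F under the
exit (typeable since `IsOrdinarilyPadicallyAutomorphic` landed; waits for the exit lead's reshaping
after the slot-zero
negative); the transverse-orientation sibling of the Steinberg pin (exact pin q² ≢ 1, no Kummer
class, Taylor's door shut,
owes a Mazur principle — card transverse-steinberg-ladder, merge-flagged with the picked line); the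
quadratic ascent
F′ = F·F₁ for the Hecke side (card eisenstein-lgc-at-nice-prime; becomes a stub of S4 when the lead
reaches it); the p = 3
corollary (ζ₃ ∉ F_v for automatic distinguishedness), the 2-adic door, the mixed-orientation case at
split p (outside SW
even at defect zero — needs both lattices deformed at once, a different card), non-parallel weight
(Calegari–Mazur
territory, not claimed), and the upgrade from a.e. Satake matching to `Corresponds` at every place
(summit-generic glue
shared with every (B)-route). Suggested disprover target (not an item): the residual-pencil floor as
a landed Negative
lemma — "r independent admissible residual cocycles ⇒ a reducible type-𝒟 point 𝔮 with dim R/𝔮 ≥ r +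
1" over
`NearlyOrdinaryDeformationRing` — which would make (K-a) a theorem-backed restatement trigger.

CHEAPEST FALSIFIER. The falsifier filed at open HAS BEEN RUN and passed: residual admissible Selmer
dimensions by class field
theory in PARI (unconditional, bnfcertify = 1) — kit j008702: for F = ℚ(√d), d ∈ {−1, −2, −3, −7,
−11}, p = 5, S = {5, 11},
the admissible (split-at-5) class of (1, ω) is UNIQUE (b₃ = 1, entirely from ℚ; no second split
Selmer class); kit j007870:
r₀ = 1 for 20 of 21 fields d ≤ 39 with the 11a3-type datum, r₀ = 2 at d = 10, Ш² = 0, h_ll ∈ {2, 3,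
4}; kit j009536:
r_S = 1 for the witness (5-rank of Cl_{5^e}(ℚ(√−10)) = 2 = V⁺ ⊕ V⁻, primes above 11 outside V⁺). So
the residual floor is
2 ≤ 3 on every worked example and the witness lies inside `UniqueAdmissibleExtension`. NEXT CHEAPEST
(one batched PARI
job + one page lookup, a refuter can run them this week): (1) r₀ and Ш² for a NON-base-change
uniform 5-isogeny curve
over the first imaginary quadratic F with rk X₀(15)(F) > 0 (r0.gp of j007870 with Σ := the curve's
bad primes,
ω^{∓1} ↦ χ̄_aχ̄_b⁻¹) — r₀ ≥ 3 fires (K-a); (2) for the witness (F = ℚ(√−2), p = 5, Ψ̄ = ω⁻¹, S♯ =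
{5, 11, 11′}) compute the
5-ranks of the ray class towers giving the torsion-ness witnesses of S3 (weak-Leopoldt defect of
F(Ψ̄)·F̃_n, n ≤ 2) and
list the Taylor–Steinberg candidates v₀ with N v₀ < 2000 (N v₀ ≡ 1 mod 5, split in F(ρ̄)) with their
Frobenius directions
in Gal(F̃₁/F) ≅ (ℤ/5)² — exhibits the thin set of S3 concretely (a direction hitting a height-one
prime of X_split) or
fires (K-b); (3) lookup arXiv:1812.09999 §6.3.2: is the axiomatic
Ihara-avoidance lemma stated over a base Λ general enough for Λ = R/𝔭₁-families (p. 73 says "Λ a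
power series ring over
𝒪") or does its application hard-wire non-Eisenstein 𝔪 — decides whether S5 needs the nice-prime
relocation first (K-c).
Second tier: Berger's divisibility 5 | L^alg(0, χ_aχ_b⁻¹) for the witness pair versus the
level-raising prime q = 31
already certified for the seed.

NUMBERS. l₀ = `Literature.Barriers.Langlands.defectGL 0 1 2` = 1. Λ_F = 𝒪⟦T₁, T₂, Y₁, Y₂⟧, Krull
dimension 5 (ℤ_p-rank of
Gal(F_S^ab/F)^(p) = r₂ + 1 = 2, Leopoldt being a theorem for F; Σ_{v∣p}[F_v : ℚ_p] = 2 inertial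
variables; SkinnerWiles1999
§2.5). Irreducible nearly ordinary components: dimension ≥ dim Λ_F − l₀ = 4 (cuspidal Hida families
Λ_F-torsion:
Hida1993Duke, CalegariMazur2008 §1; big R = 𝕋 dimension 1 + dim B − l₀, GeeNewton2020). Reducible
locus:
dim = max(r₀ + 1, 2 + max_Z(dim Z + r_Z − 1)) (SkinnerWiles1999 Lemma 2.7 at δ_F + 1 = 2); target ≤
3; margin 1 as over ℚ
(dim Λ_ℚ = 3, reducible locus 2). Measured: r₀ = 1 (witness; 20/21 fields d ≤ 39), r₀ = 2 (d = 10);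
b = [2,1,1,1] over
ℚ(√−2) (one new ω-class unramified at 5 = a lower-left tangent direction, not in the reducible
locus; one ω²-class =
dual-Selmer character); r_S = 1. Taylor–Steinberg window: N v₀ ≡ 1 (mod p), ρ̄(Frob_v₀) = 1, p > 2
(arXiv:1812.09999
§6.2.5); the pin: Ψ(Frob_v₀) ∈ {N v₀, (N v₀)⁻¹}. Decomposed genericity at p = 5 for ρ̄^ss = θ ⊕ ωθ⁻¹
(binding
2-dimensional condition after the ACC+ twist): generic v exist iff θ² ∉ {1, ω²} (ZMod 5 census,
kernel-checked).
Hecke-side ascent: F′ = F·F₁ with F₁ imaginary quadratic, p split in F₁: [F′⁺ : ℚ] = 2, l₀(F′) = 2.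
p-distinguishedness at
p = 5 is automatic for 5-isogenies (e(F_v/ℚ₅) ≤ 2 < 4). X₀(15) = 15A1, X₀(15)(ℚ) ≅ ℤ/2 × ℤ/4, rank 0
over ℚ(√−d),
d = 1, 2, 3, 5 (CaraianiNewton2023 §1). Seed instance certified: (ℚ(√−2), 5, (1, ω), M = 31). Landed
so far on this route:
2 items proved (Assembly, ModularOfProModularClassical), S1 of the engine line proved, 9 Negative
files (engine 1, seed 2,
exit 6), 1 Defs file, > 25 helper files accepted.

DEFINITION REQUESTS. (1) LANDED: Hida's ordinary part of completed cohomology and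
`TameLevel.IsOrdinarilyPadicallyAutomorphic` /
`OrdinaryHeckeAlgebraGLn` / `ordT` / `ordDiamond` / `IsOrdAssociated`
(Literature/NumberTheory/Automorphic/
OrdinaryCompletedCohomologyGL.lean) and `HasDominantDiamondWeight`
(BianchiOrdinaryClassicality.lean) — the exit's children
are typeable. (2) Still wanted as cite-grade facts (operator `cited` rulings, NOT literature-prover
seats): Hida's control
theorem for nearly ordinary cohomology of GL₂ over fields with complex places (Hida1993Duke Thm. I,
Hida1994AIF); Berger's
Eisenstein ideal bound (Berger2009 Thm. 13 hypotheses verbatim); Scholze2015 Cor. V.4.3 for CM F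
(the tree vendors the
totally real `residualRep_exists` only); CaraianiNewton2023 Prop. 5.5.2 / Thm. 4.2.15 (P-ordinary
determinants and
ordinary local–global compatibility, hypotheses (1)–(3) verbatim, including the exclusion of F = F₀
that forces the
ascent F′); KhareThorne2017 Prop. 6.6 / Cor. 6.8 / Cor. 6.15 (minimal perfect Λ-complex of the Hida
tower, any number
field); Rubin1991 two-variable main conjecture (torsion-ness and characteristic ideal of X_split);
Taylor2008 §3 /
arXiv:1812.09999 §6.2.5 (local rings R_v^1, R_v^χ at a Taylor–Steinberg place). (3) NEW definition
request: hoist the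
regime vocabulary of the picked engine line (`ModelData`, `ModelData.Models`, `baseLevel`,
`ClosedPointStratumLE`,
`UniqueAdmissibleExtension`, now in
Theorems/SkinnerWilesDefectOneReducibleOrdinaryProModularDefs.lean, which imports the
route file) into Literature/NumberTheory/GaloisRepresentations beside
`NearlyOrdinaryDeformationRing`, so that the
SmallRank/LargeRank items of the Two-layer plan can be typed in the route file. The one proof-level
cone fact this
line consumes remains `Literature.NumberTheory.Automorphic.exists_galoisRep_of_regularAlgebraic`
(lang.S27 =
HarrisLanTaylorThorneRMS2016 Thm. A at n = 2, CM K; cite-grade) — standing ruling of revs 2/4/8,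
unchanged; gate cone 0
unproved, READY.

Novelty: TRIBUNAL FILING (round 1 re-entry; rbadge g4, 2026-08-17T16:45Z; D-0033 T1′) — CONJUNCT SPLIT
DECLARED. attacked: ReducibleOrdinaryModular (target X = FM(B) on the SW sector: residually
reducible, p-distinguished, SW-oriented ordinary, parallel weight k ≥ 2, GL₂/imaginary quadratic F).
bc2: redirect ReducibleOrdinaryModular -> ReducibleOrdinaryProModular (engine) +
ProModularOrdinaryClassical (exit); assembly ModularOfProModularClassical PROVED p83517
[trivial_seam]; piece probes failed 2/2 (retro T1 not-shown ×2: engine = pro-modularity of SOME tame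
level only, exit = classicality weakened by hpm); plans 2/2 — engine: line siegel_wall_skinner_wiles
REGISTERED 2026-08-17 (crux-strategist; 7 stubs, lean rc 0, crux BY NAME; the steinberg /
generic-eisenstein / fine-selmer lines are DEAD on D1 = torsion ordinary LGC at an Eisenstein 𝔪 over
F and D2 = positive-defect Eisenstein patching,
Cruxes/ReducibleOrdinaryProModular/STRATEGY-CENSUS.md), exit: line exit_split + landed reduction
p117823 + crux #7 PROVED. residual: SectorComplement (:= X → Langlands; Langlands → SectorComplement
landed p80725; kernel iffs _iff_of_target/_iff_not_or are modulo the OPEN target) — imported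
complement, counted once per summit, never staffed; kind crux only because closes' binders must be
cruxes (glue.non-crux-hypothesis). closes unchanged (lean rc 0). bc1: cone = 2 attacked + 1
residual. bc5: engine rungs PROVED in-tree and exercising the SW lever over imaginary quadratic F,
where FM(B) for ρ̄ red  [refs: 1812.09269, 1103.5100, 0801.0091, 2411.18661, 2512.21249, 1912.11269, 1812.09999, 2301.10509, paper:arxiv-1207.4224, paper:arxiv-2301.10509, SkinnerWiles1999, AllenNewtonThorne2020, BergerKlosin2009, Akers2025, BergerKlosin2011, Thorne2014, Thorne2016, Hansen2012, AHTW2026, CalegariGeraghty2017]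

Barriers (technique_class: skinner-wiles residually-reducible hida-theory level-raising): - technique_class: skinner-wiles residually-reducible residual-eisenstein-characters
non-split-extension mazur-deformation-condition auxiliary-steinberg-primes level-raising
ribet-congruence hida-theory nearly-ordinary classicality betti-cohomology
calegari-geraghty-patching positive-defect defect-one automorphy-lifting modularity-lifting
pro-modularity
- bc8 PLACEMENT (tribunal round 1): ReducibleOrdinaryProModular (engine, attacked) —
ResiduallyReducibleBarrier/Narrow: INSIDE the class, evaded (no TW primes relative to ρ̄; fixed
non-split oriented extension; reducible locus bounded by Iwasawa theory + auxiliary Steinberg pin;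
SW escape (a)); TaylorWilesNumericalCoincidence/Narrow: INSIDE (l₀ = 1), met by CG/Hansen/KT
two-term complexes, printed only for ρ̄ irreducible [corpus:paper:arxiv-1207.4224 p.2] — the engine
IS that extension; PatchingLocalComponentBarrier: bites S5 only, paid by Taylor's Ihara avoidance at
a TaylorSteinbergPlace; ShimuraVarietyRealization: outside (torsion determinants imported);
SolvableImage: outside (no Galois-side base change — the point of the pin).
ProModularOrdinaryClassical (exit, attacked) — NonRegularWeightBarrier/Narrow: OUTSIDE (regular
parallel weight k ≥ 2); ModPLanglandsGL2BeyondQp/PaskunasCentreFinitenessFails: OUTSIDE (ordinary at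
p, Hida theory; no p-adic LL for GL₂(F_v)); FamilyWitnessConsecutiveWeights,
MonodromyNotClosedUnderPadicLimits, TwistedEndoscopySelfDual, ShtukaConstantField: not engaged.
SectorComplement (RESIDUAL) — re

History (route lifecycle, newest last):
- 2026-08-17T16:48:31Z · LINT AUTOFIX route.multi-assembly: kept Assembly, dropped Assembly2 (gate:hygiene)
- 2026-08-17T16:48:47Z · rev 26: dropped stmt-Langlands-15746 — rbadge g4 housekeeping: closes re-submitted UNCHANGED (term identical to g2's certification; comment refreshed: attacked X via engine ∧ exit, residual SectorCom (planner-rbadge-Langlands-SkinnerWilesDefectOne-dd49536c-g4-0)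

sub-problem: Langlands · status: draft · opened planner-plancard-Langlands-Langlands-eisenste-8ec25c50-g2-0 2026-08-15T18:56:48Z · rev 29 · ledger route-Langlands-SkinnerWilesDefectOne
GENERATED by the gate from the ledger (D-0016/17). Provers cite these decls: `theorem foo : Summit.Langlands.Langlands.Theses.SkinnerWilesDefectOne.<Decl> := …` in Summits/Langlands/Langlands/Theorems/<Name>.lean.
-/

namespace Summit.Langlands.Langlands.Theses.SkinnerWilesDefectOne

open scoped BigOperators Topology Manifold Classical MeasureTheory ProbabilityTheory Matrix InnerProductSpace ComplexConjugate ContinuousMap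
open Filter Set Function TopologicalSpace MeasureTheory

attribute [summit_statement] _root_.Langlands

/-- item stmt-Langlands-12918 · target · rank 0 · open · by planner
why it might fail: = Fontaine–Mazur (B) in the residually reducible, p-distinguished, SW-oriented ordinary parallel-weight sector over imaginary quadratic F; only sub-cases proved (BergerKlosin2009/2011 minimal r₀ = 1, Akers2025): false only if FM fails there. Typing audited ×3 (Frobenius, orientation, O pinned).
sources: SkinnerWiles1999, FontaineMazurGeometric1995, BergerKlosin2009, BergerKlosin2011, Akers2025, arXiv:2301.10509
[target] Thesis X above: Skinner–Wiles Theorem A over an imaginary quadratic F (IsTotallyComplex ∧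
finrank ℚ F = 2), p ≠ 2, O pinned to the valuation ring of ℚ̄_p, ρ irreducible and a.e. unramified
with a residually upper-triangular integral model ρ₀ (`HasUpperTriangularIntegralModel`), one
parallel weight k ≥ 2 and exponent m ≥ 1 such that at every v ∣ p: `IsPDistinguishedAt ρ₀ v` and an
ORIENTED ordinary frame Q (‖Q₀₀‖ ≤ ‖Q₁₀‖; lower-left of Q⁻¹ρ|D_vQ vanishes; on inertia θ₂^m = 1,
θ₁^m = ε^{(k-1)m}, the clause of `isOrdinaryOfWeightAt_iff_padicAlgCl`) ⟹ ∃ L-algebraic cuspidal π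
with `SatakeFrobCompatibleAt ι π ρ v` for cofinitely many v. Sector of
`Summit.Langlands.GaloisToAutomorphic 2` (Satake form; ordinary ⇒ de Rham, no PstWeilDeligneData
touched). Non-vacuous: ρ = T₅(11a1)|Γ_F for F = ℚ(√-2) with the isogeny-adapted lattice meets every
hypothesis. -/
@[route_item "route-Langlands-SkinnerWilesDefectOne"]
def ReducibleOrdinaryModular : Prop :=
  ∀ (F : Type) [Field F] [NumberField F], NumberField.IsTotallyComplex F → Module.finrank ℚ F = 2 → ∀ (p : ℕ) [Fact p.Prime], p ≠ 2 → ∀ (O : ValuationSubring (PadicAlgCl p)), O = (Valued.v : Valuation (PadicAlgCl p) NNReal).valuationSubring → ∀ (hcpt : Literature.NumberTheory.Automorphic.isCompact_glFiniteIntegralLevel 2 F) (ι : PadicAlgCl p ≃+* ℂ) (ρ : Literature.NumberTheory.GaloisRepresentations.FramedGaloisRep F (PadicAlgCl p) 2) (ρ₀ : Field.absoluteGaloisGroup F →* Matrix.GeneralLinearGroup (Fin 2) O), ρ.toGaloisRep.IsIrreducible → (∀ᶠ v in cofinite, ρ.IsUnramifiedAt v) → ρ.HasUpperTriangularIntegralModel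 ρ₀ → (∃ k : ℕ, 2 ≤ k ∧ ∃ m : ℕ, 0 < m ∧ ∀ v : IsDedekindDomain.HeightOneSpectrum (NumberField.RingOfIntegers F), (p : NumberField.RingOfIntegers F) ∈ v.asIdeal → Literature.NumberTheory.GaloisRepresentations.IsPDistinguishedAt ρ₀ v ∧ ∃ Q : Matrix.GeneralLinearGroup (Fin 2) (PadicAlgCl p), Valued.v (Q.val 0 0) ≤ Valued.v (Q.val 1 0) ∧ ∀ σ, (Q⁻¹ * ρ.toLocal v σ * Q).val 1 0 = 0 ∧ (σ ∈ Literature.NumberTheory.GaloisRepresentations.absInertia (v.adicCompletion F) → (Q⁻¹ * ρ.toLocal v σ * Q).val 1 1 ^ m = 1 ∧ (Q⁻¹ * ρ.toLocal v σ * Q).val 0 0 ^ m = algebraMap (Padic p) (PadicAlgCl p) (((Literature.NumberTheory.GaloisRepresentations.GaloisRep.cyclotomicCharacter (v.adicCompletion F) p σ).val : PadicInt p) : Padic p) ^ ((k - 1) * m))) → ∃ π : Literature.NumberTheory.Automorphic.CuspidalAutomorphicRepData 2 F hcpt, π.1.IsLAlgebraic ∧ ∀ᶠ v in cofinite, Summit.Langlands.SatakeFrobCompatibleAt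 ι π.1 ρ v

/-- item stmt-Langlands-12919 · crux · rank 2 · open · by planner
why it might fail: Mechanism covers r₀ ≤ 2 only (residual pencil: dim R^red ≥ r₀+1; r₀ = 1 at the witness and 20/21 fields, kit j007870). At l₀=1 an auxiliary Steinberg pin replaces SW base change (thin-set avoidance of Supp X_split); crossing S5 = non-minimal (P1) in positive defect (PLC barrier); no torsion LGC /F.
sources: SkinnerWiles1999, CalegariGeraghty2017, Hansen2012, KhareThorne2017, AllenNewtonThorne2020, Thorne2014
[crux] THE ENGINE (card Z1+Z3, SW Main Theorem at defect one; conclusion = SW's "ρ is pro-modular",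
Emerton/Hansen "p-adically automorphic"). Same binders and hypotheses as the target minus (hcpt, ι);
conclusion: there is an S-good tame level 𝒰 : BigHeckeGLn.TameLevel 2 F p such that ρ is associated
with a CONTINUOUS ℚ̄_p-valued point x of the completed-cohomology Hecke algebra 𝕋(𝒰) of the Bianchi
tower (`𝒰.IsPadicallyAutomorphic ρ`: ρ unramified at v ∉ 𝒰.bad and charpoly ρ(Frob_v) = x(X² − T_v,1
X + q_v T_v,2), arithmetic Frobenius — the homological normalisation forced by det ρ|I_v =
ε^{k-1}·finite). For irreducible ρ the point cannot be an Eisenstein/boundary point (those carry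
reducible pseudo-characters), so this is cuspidal pro-modularity. Intended proof: R_𝒟 =
NearlyOrdinaryDeformationRing of the residual extension (oriented lattice, c split at v ∣ p) over
Λ_F = 𝒪[[T₁,T₂,Y₁,Y₂]] (Krull dim 5; cuspidal Hida families are Λ_F-torsion,
CalegariMazur2008/Hida1993Duke, so "large" = dim ≥ 4 = dim Λ_F − l₀); reducible locus of dim ≤ 3
(generic rank of H¹(F_S, Ψ_aΨ_b⁻¹) is 1 by weak Leopoldt for abelian-over-F fields, two local
splitting conditions); good dimension-one primes 𝔭 on ev -/
@[route_item "route-Langlands-SkinnerWilesDefectOne", crux (bottleneck := idea) (source := "director LANGLANDS l.25, 2026-09-01")]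
def ReducibleOrdinaryProModular : Prop :=
  ∀ (F : Type) [Field F] [NumberField F], NumberField.IsTotallyComplex F → Module.finrank ℚ F = 2 → ∀ (p : ℕ) [Fact p.Prime], p ≠ 2 → ∀ (O : ValuationSubring (PadicAlgCl p)), O = (Valued.v : Valuation (PadicAlgCl p) NNReal).valuationSubring → ∀ (ρ : Literature.NumberTheory.GaloisRepresentations.FramedGaloisRep F (PadicAlgCl p) 2) (ρ₀ : Field.absoluteGaloisGroup F →* Matrix.GeneralLinearGroup (Fin 2) O), ρ.toGaloisRep.IsIrreducible → (∀ᶠ v in cofinite, ρ.IsUnramifiedAt v) → ρ.HasUpperTriangularIntegralModel ρ₀ → (∃ k : ℕ, 2 ≤ k ∧ ∃ m : ℕ, 0 < m ∧ ∀ v : IsDedekindDomain.HeightOneSpectrum (NumberField.RingOfIntegers F), (p : NumberField.RingOfIntegers F) ∈ v.asIdeal → Literature.NumberTheory.GaloisRepresentations.IsPDistinguishedAt ρ₀ v ∧ ∃ Q : Matrix.GeneralLinearGroup (Fin 2) (PadicAlgCl p), Valued.v (Q.val 0 0) ≤ Valued.v (Q.val 1 0) ∧ ∀ σ, (Q⁻¹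 * ρ.toLocal v σ * Q).val 1 0 = 0 ∧ (σ ∈ Literature.NumberTheory.GaloisRepresentations.absInertia (v.adicCompletion F) → (Q⁻¹ * ρ.toLocal v σ * Q).val 1 1 ^ m = 1 ∧ (Q⁻¹ * ρ.toLocal v σ * Q).val 0 0 ^ m = algebraMap (Padic p) (PadicAlgCl p) (((Literature.NumberTheory.GaloisRepresentations.GaloisRep.cyclotomicCharacter (v.adicCompletion F) p σ).val : PadicInt p) : Padic p) ^ ((k - 1) * m))) → ∃ 𝒰 : Literature.NumberTheory.Automorphic.BigHeckeGLn.TameLevel 2 F p, 𝒰.IsPadicallyAutomorphic ρ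

/-- item stmt-Langlands-12921 · crux · rank 4 · open · by planner
why it might fail: Open core (OF): Galois-ordinary ⇒ the 𝕋(𝒰)-point factors through Hida's ordinary part — Emerton's argument is GL₂(ℚ_p)-only; over F only the converse is known (CaraianiNewton2023, AHTW2026); naive slot-zero diamond weight refuted mod a companion point (Negative/SlotZeroWeight); H² torsion (control).
sources: Hida1993Duke, Hida1994AIF, KhareThorne2017, SkinnerWiles1999, Emerton2011LocalGlobal, arXiv:2301.10509
[crux] THE EXIT (card Z4; SW Prop. 3.7 / Hida control, typed WITHOUT residual hypotheses so that it
dedups with any GL₂/F route): for F imaginary quadratic, p odd, every irreducible ρ : Γ_F →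
GL₂(ℚ̄_p), unramified a.e., that is p-adically automorphic of some tame level (`∃ 𝒰,
𝒰.IsPadicallyAutomorphic ρ`) and ordinary of ONE parallel weight k ≥ 2 with exponent m at every v ∣
p (`IsOrdinaryOfWeightAt`, no orientation needed) is classically automorphic: ∃ L-algebraic cuspidal
π on GL₂(𝔸_F) with Satake–Frobenius matching a.e. Intended proof: the point x of 𝕋(𝒰) attached to ρ
factors through Hida's nearly ordinary quotient (ordinary local–global compatibility at v ∣ p for
completed cohomology, Galois side ⇒ U_v-slope 0), Hida's control theorem for GL₂ over F in
cohomological degrees 1–2 (Hida1993Duke, Hida1994AIF: exact up to bounded torsion, enough for a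
characteristic-0 eigensystem of arithmetic weight), then the Eichler–Shimura–Harder /
Franke–Borel–Jacquet dictionary from a cuspidal Bianchi eigenclass of weight (k,k) to an L-algebraic
cuspidal π with T_v ↦ Satake parameters (`hasSatakeParamAt_iff_L2`,
`exists_cuspidalRepData_of_L2_holds`). [difficulty: L] -/
@[route_item "route-Langlands-SkinnerWilesDefectOne", crux]
def ProModularOrdinaryClassical : Prop :=
  ∀ (F : Type) [Field F] [NumberField F], NumberField.IsTotallyComplex F → Module.finrank ℚ F = 2 → ∀ (p : ℕ) [Fact p.Prime], p ≠ 2 → ∀ (hcpt : Literature.NumberTheory.Automorphic.isCompact_glFiniteIntegralLevel 2 F) (ι : PadicAlgCl p ≃+* ℂ) (ρ : Literature.NumberTheory.GaloisRepresentations.FramedGaloisRep F (PadicAlgCl p) 2), ρ.toGaloisRep.IsIrreducible → (∀ᶠ v in cofinite, ρ.IsUnramifiedAt v) → (∃ 𝒰 : Literature.NumberTheory.Automorphic.BigHeckeGLn.TameLevel 2 F p, 𝒰.IsPadicallyAutomorphic ρ) → (∃ k : ℕ, 2 ≤ k ∧ ∃ m : ℕ, 0 < m ∧ ∀ v : IsDedekindDomain.HeightOneSpectrum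 (NumberField.RingOfIntegers F), (p : NumberField.RingOfIntegers F) ∈ v.asIdeal → ρ.IsOrdinaryOfWeightAt p v k m) → ∃ π : Literature.NumberTheory.Automorphic.CuspidalAutomorphicRepData 2 F hcpt, π.1.IsLAlgebraic ∧ ∀ᶠ v in cofinite, Summit.Langlands.SatakeFrobCompatibleAt ι π.1 ρ v

/-- item stmt-Langlands-15362 · crux · rank 7 · closed · proved by Summit.Langlands.Langlands.Theorems.BianchiCongruenceCohomologyFinite_proof @ 418cb9eea1f6 (prover) · by planner
why it might fail: Theorem on paper (Serre1971 §2.4 Th.4(a); BorelSerre1973 Thm 11.4.4: arithmetic groups are (WFL)), XL in Lean: needs ℍ³/ℚ-rank-1 reduction theory or a Γ-finite contractible complex + cellular resolution, none in Mathlib; junk-free as typed (Γ_U commensurable with GL₂(𝓞_K), proved in tree).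
sources: BorelSerre1973, Serre1971CohomologieGroupesDiscrets, Brown1982CohomologyGroups, Raghunathan1968, Swan1971, ElstrodtGrunewaldMennicke1998
[crux] PROMOTED IMPORT #3 — clean re-filing of stmt-Langlands-15711, which the gate mis-kinded from
a keyword of its informal and rendered under a wrong decl name (same statement with the two field
hypotheses in the other order; that item is HELD for the tenure planner / operator to drop) —
(route-choice repair 2026-08-16 on the exit's line file
Cruxes/ProModularOrdinaryClassical/Lines/top_degree_exact_control: the named fact
Literature.NumberTheory.Automorphic.BorelSerre1973_finite_groupCohomology_congruenceSubgroup — ALL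
n, ALL number fields: general Borel–Serre corners + reduction theory — was judged XL-apex as the
fact-stub `stub_fact_borelSerreCongruence` of the exit's picked line, and non-crux Literature facts
are not split; as a crux it gets lineage + one layer of 2–7 subs). BOREL–SERRE FINITENESS FOR GL₂
OVER IMAGINARY QUADRATIC FIELDS — exactly the instance the line consumes (its stub 3
`stub_hidaCohomology_finite` is applied only at the crux's imaginary quadratic F, to make Hida's
idempotent exist on the finite pieces H^i(X_{U(r)}, ℤ/p^s), KhareThorne2017 Lemma 2.10 = landed
stub_slopeZeroFactorisation p98105): for K imaginary quadratic (IsTotallyComplex ∧ finrank ℚ K = 2 -/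
@[route_item "route-Langlands-SkinnerWilesDefectOne", crux]
def BianchiCongruenceCohomologyFinite : Prop :=
  ∀ (K : Type) [Field K] [NumberField K], Module.finrank ℚ K = 2 → NumberField.IsTotallyComplex K → ∀ (U : Subgroup (Literature.NumberTheory.Automorphic.BigHeckeGLn.FiniteAdelicGL 2 K)), IsOpen (U : Set (Literature.NumberTheory.Automorphic.BigHeckeGLn.FiniteAdelicGL 2 K)) → IsCompact (U : Set (Literature.NumberTheory.Automorphic.BigHeckeGLn.FiniteAdelicGL 2 K)) → ∀ (A : Rep ℤ (U.comap (Literature.NumberTheory.Automorphic.BigHeckeGLn.globalEmbedding 2 K))), Finite A → ∀ q : ℕ, Finite (groupCohomology A q)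

/-- item stmt-Langlands-12923 · crux · rank 9 · open · by planner
why it might fail: The REST of GL_n reciprocity outside one GL₂/imaginary-quadratic residually-reducible ordinary sector (all n, all F, direction (A), every place, 𝓡) is wide open (Fontaine–Mazur; non-regular π); `Langlands` as typed may over-claim in corners (even ρ, irregular π). Imported complement; judge #2/#3/#4.
sources: BuzzardGeeLMS2014, FontaineMazurGeometric1995, Calegari2023
[support] COMPLEMENT OF THE SECTOR = the rest of the summit: `ReducibleOrdinaryModular → Langlands`
— every n ≠ 2, every F not imaginary quadratic, direction (A), the residually irreducible /
non-ordinary / mixed-orientation / non-parallel parts of (B), local–global compatibility at EVERY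
place (`Corresponds`) and the reciprocity data 𝓡. NOT attacked by this route and not expected to
close before the summit itself; trivially implied by `Langlands`. Filed only so that the deciding
theorem `closes : ReducibleOrdinaryProModular → ProModularOrdinaryClassical → SectorComplement →
Langlands` ends in the summit constant BY NAME (D-0027 §2.1; same convention as
AnalyticDescent.SectorComplement, GaloisWeightedBE.SectorComplement,
CapacityClassicality.SectorToLanglands). Graders/refuters: judge the route on
ReducibleOrdinaryProModular / EisensteinProModularSeed / ProModularOrdinaryClassical / the Target,
never on this item; never staff it from this route. [difficulty: open-problem] -/
@[route_item "route-Langlands-SkinnerWilesDefectOne", crux]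
def SectorComplement : Prop :=
  ReducibleOrdinaryModular → _root_.Langlands

/-- item stmt-Langlands-12920 · aside · rank 3 · open · by planner
why it might fail: Imported from ℚ only on the Billerey–Menares range (p ≥ 5, ratio descends to an odd character in the Serre-weight window; instance (ℚ(√−2), 5, (1,ω), M=31) certified). Else Berger2009 Thm 13 needs p split, p ∤ h_F·#(𝒪/𝔣)ˣ, H²_c torsion-free, p | L^alg(0,χ); Eisenstein level raising w/ torsion open.
sources: Berger2009, arXiv:math/0701177, BergerKlosin2011, Ribet1976, DiamondTaylor1994, SkinnerWiles1999
[crux] THE ENTRANCE (card Z2; SW step (II) "R_𝒟 has a nice prime for some extension c₀", their §3.4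
Eisenstein congruence, at MINIMAL LEVEL up to ONE level-raising place — level-controlled so that it
is not implied by the engine applied to ρ itself). Same binders/hypotheses as the engine;
conclusion: there are a tame level 𝒰, an IRREDUCIBLE r : Γ_F → GL₂(ℚ̄_p) that is p-adically
automorphic of level 𝒰, an integral model r₀ of r upper triangular mod 𝔪 with the SAME ordered
residual diagonal as ρ₀ ((r₀ g)_ii ≡ (ρ₀ g)_ii mod 𝔪), r oriented-ordinary of some parallel weight
k' ≥ 2 at every v ∣ p (so r is a point of the same R_𝒟-type problem, possibly for another extension
class — SW transport the class afterwards), and ONE auxiliary finite place q such that every v ≠ q,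
v ∤ p at which both residual characters are unramified (inertia entries of ρ₀ ≡ 1 mod 𝔪) lies
outside 𝒰.bad (the tame level is hyperspecial there: an Eisenstein congruence at the conductor of
(χ̄_a, χ̄_b) times p^∞ times one level-raising prime). Intended proof: ordinary Eisenstein
cohomology class of the Bianchi group for (χ_a, χ_b) (Harder1987), Berger's lower bound on the
Eisenstein ideal index by L^alg(0, χ_aχ_b⁻¹·) -/
@[route_item "route-Langlands-SkinnerWilesDefectOne", crux]
def EisensteinProModularSeed : Prop :=
  ∀ (F : Type) [Field F] [NumberField F], NumberField.IsTotallyComplex F → Module.finrank ℚ F = 2 → ∀ (p : ℕ) [Fact p.Prime], p ≠ 2 → ∀ (O : ValuationSubring (PadicAlgCl p)), O = (Valued.v : Valuation (PadicAlgCl p) NNReal).valuationSubring → ∀ (ρ : Literature.NumberTheory.GaloisRepresentations.FramedGaloisRep F (PadicAlgCl p) 2) (ρ₀ : Field.absoluteGaloisGroup F →* Matrix.GeneralLinearGroup (Fin 2) O), ρ.toGaloisRep.IsIrreducible → (∀ᶠ v in cofinite, ρ.IsUnramifiedAt v) → ρ.HasUpperTriangularIntegralModel ρ₀ → (∃ k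 : ℕ, 2 ≤ k ∧ ∃ m : ℕ, 0 < m ∧ ∀ v : IsDedekindDomain.HeightOneSpectrum (NumberField.RingOfIntegers F), (p : NumberField.RingOfIntegers F) ∈ v.asIdeal → Literature.NumberTheory.GaloisRepresentations.IsPDistinguishedAt ρ₀ v ∧ ∃ Q : Matrix.GeneralLinearGroup (Fin 2) (PadicAlgCl p), Valued.v (Q.val 0 0) ≤ Valued.v (Q.val 1 0) ∧ ∀ σ, (Q⁻¹ * ρ.toLocal v σ * Q).val 1 0 = 0 ∧ (σ ∈ Literature.NumberTheory.GaloisRepresentations.absInertia (v.adicCompletion F) → (Q⁻¹ * ρ.toLocal v σ * Q).val 1 1 ^ m = 1 ∧ (Q⁻¹ * ρ.toLocal v σ * Q).val 0 0 ^ m = algebraMap (Padic p) (PadicAlgCl p) (((Literature.NumberTheory.GaloisRepresentations.GaloisRep.cyclotomicCharacter (v.adicCompletion F) p σ).val : PadicInt p) : Padic p) ^ ((k - 1) * m))) → ∃ (𝒰 : Literature.NumberTheory.Automorphic.BigHeckeGLn.TameLevel 2 F p) (r : Literature.NumberTheory.GaloisRepresentations.FramedGaloisRep F (PadicAlgCl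 p) 2) (r₀ : Field.absoluteGaloisGroup F →* Matrix.GeneralLinearGroup (Fin 2) O) (q : IsDedekindDomain.HeightOneSpectrum (NumberField.RingOfIntegers F)), r.toGaloisRep.IsIrreducible ∧ 𝒰.IsPadicallyAutomorphic r ∧ r.HasUpperTriangularIntegralModel r₀ ∧ (∀ g, ((r₀ g).val 0 0 - (ρ₀ g).val 0 0 : O) ∈ IsLocalRing.maximalIdeal O ∧ ((r₀ g).val 1 1 - (ρ₀ g).val 1 1 : O) ∈ IsLocalRing.maximalIdeal O) ∧ (∃ k : ℕ, 2 ≤ k ∧ ∃ m : ℕ, 0 < m ∧ ∀ v : IsDedekindDomain.HeightOneSpectrum (NumberField.RingOfIntegers F), (p : NumberField.RingOfIntegers F) ∈ v.asIdeal → ∃ Q : Matrix.GeneralLinearGroup (Fin 2) (PadicAlgCl p), Valued.v (Q.val 0 0) ≤ Valued.v (Q.val 1 0) ∧ ∀ σ, (Q⁻¹ * r.toLocal v σ * Q).val 1 0 = 0 ∧ (σ ∈ Literature.NumberTheory.GaloisRepresentations.absInertia (v.adicCompletion F) → (Q⁻¹ * r.toLocal v σ * Q).val 1 1 ^ m = 1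 ∧ (Q⁻¹ * r.toLocal v σ * Q).val 0 0 ^ m = algebraMap (Padic p) (PadicAlgCl p) (((Literature.NumberTheory.GaloisRepresentations.GaloisRep.cyclotomicCharacter (v.adicCompletion F) p σ).val : PadicInt p) : Padic p) ^ ((k - 1) * m))) ∧ (∀ v : IsDedekindDomain.HeightOneSpectrum (NumberField.RingOfIntegers F), v ≠ q → (p : NumberField.RingOfIntegers F) ∉ v.asIdeal → (∀ 𝔓 ∈ v.primesAbove, ∀ σ ∈ 𝔓.inertia (Field.absoluteGaloisGroup F), ((ρ₀ σ).val 0 0 - 1 : O) ∈ IsLocalRing.maximalIdeal O ∧ ((ρ₀ σ).val 1 1 - 1 : O) ∈ IsLocalRing.maximalIdeal O) → v ∉ 𝒰.bad)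

/-- item stmt-Langlands-15156 · aside · rank 5 · open · by planner
why it might fail: Theorem in print (Langlands 1980; AC89 Thm 4.2(a)+5.1; Carayol86 Thm (A)), XL in Lean: implied by 3 cited all-n facts (p94458/p95031), none discharged at n=2; false only as typed (normalisations audited, rattack survives). The every-w∤p clause at ramified primes of π needs fact (3) itself.
sources: LanglandsBaseChange1980, ArthurClozelAMS120, Jacquet1972GL2II, CarayolASENS1986, HarrisLanTaylorThorneRMS2016
[crux] PROMOTED IMPORT (route-choice repair 2026-08-16: the named fact
Literature.NumberTheory.Automorphic.baseChange_cyclic_cuspidal was judged XL-apex twice — too large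
for one literature seat, not splittable as a non-crux). LANGLANDS' QUADRATIC BASE CHANGE FOR GL₂
FROM ℚ TO A QUADRATIC FIELD, IN THE GALOIS-COMPATIBLE FORM that stub S4
`stub_quadraticBaseChangeTwist` of the seed's picked line descend-raise-basechange consumes: for F/ℚ
quadratic, p, ι : ℚ̄_p ≃ ℂ, π cuspidal on GL₂(𝔸_ℚ) with a regular L-algebraic infinity type T, ρ :
Γ_ℚ → GL₂(ℚ̄_p) Satake–Frobenius compatible with π at almost all places and with ρ|Γ_F IRREDUCIBLE
(so π is not dihedral w.r.t. F), there is a CUSPIDAL P on GL₂(𝔸_F) of infinity type T^F (=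
T.baseChange F, written unfolded: τ ↦ T(τ|_ℚ)) with SatakeFrobCompatibleAt ι P (ρ|Γ_F) w at EVERY
finite w ∤ p where ρ|Γ_F is unramified. It replaces, as ONE route obligation, the three
trace-formula-size named facts prepended to S4 (p90411): baseChange_cyclic_cuspidal (AC89 Ch. 3 Thm
4.2 (a): cuspidality of the weak lift; in Literature already reduced to
ArthurClozel1989_weakLifting_cuspidal + multiplicity_one_gl),
ArthurClozel1989_strongLifting_archimedean (Thm 5. -/
@[route_item "route-Langlands-SkinnerWilesDefectOne"]
def QuadraticBaseChangeGalois : Prop :=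
  ∀ (F : Type) [Field F] [NumberField F], Module.finrank ℚ F = 2 → ∀ (p : ℕ) [Fact p.Prime] (hcptQ : Literature.NumberTheory.Automorphic.isCompact_glFiniteIntegralLevel 2 ℚ) (hcptF : Literature.NumberTheory.Automorphic.isCompact_glFiniteIntegralLevel 2 F) (ι : PadicAlgCl p ≃+* ℂ) (π : Literature.NumberTheory.Automorphic.CuspidalAutomorphicRepData 2 ℚ hcptQ) (T : Literature.NumberTheory.Automorphic.InfinityType ℚ 2), π.1.HasInfinityType T → T.IsLAlgebraic → T.IsRegular → ∀ (ρ : Literature.NumberTheory.GaloisRepresentations.FramedGaloisRep ℚ (PadicAlgCl p) 2), (∀ᶠ v in Filter.cofinite, Summit.Langlands.SatakeFrobCompatibleAt ι π.1 ρ v) → (ρ.restrictField F).toGaloisRep.IsIrreducible → ∃ P : Literature.NumberTheory.Automorphic.CuspidalAutomorphicRepData 2 F hcptF, P.1.HasInfinityType (fun τ => T (τ.comp (algebraMap ℚ F))) ∧ ∀ w : IsDedekindDomain.HeightOneSpectrum (NumberField.RingOfIntegers F), (p : NumberField.RingOfIntegers F) ∉ w.asIdeal → (ρ.restrictField F).IsUnramifiedAt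 w → Summit.Langlands.SatakeFrobCompatibleAt ι P.1 (ρ.restrictField F) w

/-- item stmt-Langlands-15194 · support · rank 6 · open · by planner
[crux] PROMOTED IMPORT #2 (route-choice repair 2026-08-16, gen 1: the named fact
Literature.NumberTheory.Automorphic.ArthurClozel1989_strongLifting_allFinite was judged XL-apex —
its split child was reviewed twice without landing, and non-crux Literature facts are not split; as
a crux it gets lineage + one layer of 2–7 subs on its final cycle). ARTHUR–CLOZEL STRONG LIFTING AT
ALL FINITE PLACES (Ann. of Math. Stud. 120, Ch. 3 Thm. 5.1 with §1 (1.1), Def. 1.1–1.2, Def. 4.1 and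
the local lifting of unramified representations Ch. 1 §6; for n = 2 it is Langlands, Base change for
GL(2), 1980), stated VERBATIM INLINE (`IsWeakBaseChangeLiftAE π.1 P.1` unfolded by its Iff.rfl
lemma, so no extra import) — definitionally the Literature fact (planner Sketch.lean
`strongLiftingAllFinite_iff : StrongLiftingAllFinite ↔ ArthurClozel1989_strongLifting_allFinite :=
Iff.rfl`, lean check rc 0), not an alias of the constant (cone rule, as for
IrreducibilityBySelfDuality.GaloisRepOfRegularAlgebraic): the day
`ArthurClozel1989_strongLifting_allFinite_holds` lands this item closes in one line, and a proof of
this item discharges the fact for every route. STATEMENT: for E/F Galois of prime degree (hence cy -/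
@[route_item "route-Langlands-SkinnerWilesDefectOne"]
def StrongLiftingAllFinite : Prop :=
  ∀ (n : ℕ) (F E : Type) [Field F] [NumberField F] [Field E] [NumberField E] [Algebra F E] [IsGalois F E], (Module.finrank F E).Prime → ∀ (hF : Literature.NumberTheory.Automorphic.isCompact_glFiniteIntegralLevel n F) (hE : Literature.NumberTheory.Automorphic.isCompact_glFiniteIntegralLevel n E) (π : Literature.NumberTheory.Automorphic.CuspidalAutomorphicRepData n F hF) (P : Literature.NumberTheory.Automorphic.CuspidalAutomorphicRepData n E hE), (∀ᶠ w : IsDedekindDomain.HeightOneSpectrum (NumberField.RingOfIntegers E) in Filter.cofinite, ∀ (v : IsDedekindDomain.HeightOneSpectrum (NumberField.RingOfIntegers F)) (α : Multiset ℂ), w.asIdeal.under (NumberField.RingOfIntegers F) = v.asIdeal → π.1.HasSatakeParamAt v α → P.1.HasSatakeParamAt w (α.map (· ^ w.asIdeal.inertiaDeg (NumberField.RingOfIntegers F)))) → ∀ (w : IsDedekindDomain.HeightOneSpectrum (NumberField.RingOfIntegers E)) (v : IsDedekindDomain.HeightOneSpectrum (NumberField.RingOfIntegers F)) (α : Multiset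 ℂ), w.asIdeal.under (NumberField.RingOfIntegers F) = v.asIdeal → π.1.HasSatakeParamAt v α → P.1.HasSatakeParamAt w (α.map (· ^ w.asIdeal.inertiaDeg (NumberField.RingOfIntegers F)))

/-- item stmt-Langlands-12922 · support · rank 9 · closed · proved by Summit.Langlands.Langlands.Theorems.FiveIsogenyEllipticCurves.fiveIsogenyEllipticCurves_proof (prover) · by planner
sources: arXiv:2301.10509, SkinnerWiles1999, ACCGHLNSTT2023
[support] HEADLINE COROLLARY (glue from X; does not drive staffing): X ⇒ for every imaginary
quadratic F and every Weierstrass model E over 𝓞_F with Δ ≠ 0 and no geometric CM, carrying an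
F-rational 5-isogeny (a nonzero 5-torsion geometric point P whose line is Γ_F-stable) OF UNIFORM
TYPE above 5 (either inertia at every v ∣ 5 fixes P — kernel étale everywhere — or inertia at every
v ∣ 5 acts trivially on E[5]/⟨P⟩ — kernel multiplicative everywhere; automatic when 5 is inert or
ramified in F; the mixed type at split 5 is outside Skinner–Wiles even over ℚ-like settings and is
deliberately excluded) and with good ORDINARY reduction at every v ∣ 5 (Δ(E mod v) ≠ 0, 5 ∤ a_v),
there is an L-algebraic cuspidal π on GL₂(𝔸_F) with Σ_j α_j⁻¹ = a_w(E), Π_j α_j⁻¹ = N w at almost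
all w (lang.S28 shape, L = F). This is the population (infinite exactly when rk X₀(15)(F) > 0) that
CaraianiNewton2023 Thm 1.1 must omit. Proof plan: ρ = T₅E ⊗ ℚ̄₅ framed on the lattice T₅E (étale
case, e₀ ↦ a lift of P) resp. on the lattice 5⁻¹ℤ₅P̃ + T₅E (multiplicative case: same V₅E, other
orientation — no isogenous curve needed); ρ₀ upper triangular mod 𝔪; irreducible (no CM); ordinary
of weight k = 2, m = 1 at v ∣ -/
@[route_item "route-Langlands-SkinnerWilesDefectOne"]
def FiveIsogenyEllipticCurves : Prop :=
  ReducibleOrdinaryModular → ∀ (F : Type) [Field F] [NumberField F], NumberField.IsTotallyComplex F → Module.finrank ℚ F = 2 → ∀ (E : WeierstrassCurve (NumberField.RingOfIntegers F)), E.Δ ≠ 0 → ¬ (E.baseChange F).HasCM → (∃ P : (E.baseChange F).geomPoints, P ≠ 0 ∧ (5 : ℕ) • P = 0 ∧ (∀ σ : Field.absoluteGaloisGroup F, ∃ a : ℕ, σ • P = a • P) ∧ ((∀ v : IsDedekindDomain.HeightOneSpectrum (NumberField.RingOfIntegers F), (5 : NumberField.RingOfIntegers F) ∈ v.asIdeal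 → ∀ 𝔓 ∈ v.primesAbove, ∀ σ ∈ 𝔓.inertia (Field.absoluteGaloisGroup F), σ • P = P) ∨ (∀ v : IsDedekindDomain.HeightOneSpectrum (NumberField.RingOfIntegers F), (5 : NumberField.RingOfIntegers F) ∈ v.asIdeal → ∀ 𝔓 ∈ v.primesAbove, ∀ σ ∈ 𝔓.inertia (Field.absoluteGaloisGroup F), ∀ R : (E.baseChange F).geomPoints, (5 : ℕ) • R = 0 → ∃ a : ℕ, σ • R - R = a • P))) → (∀ v : IsDedekindDomain.HeightOneSpectrum (NumberField.RingOfIntegers F), (5 : NumberField.RingOfIntegers F) ∈ v.asIdeal → (E.map (Ideal.Quotient.mk v.asIdeal)).Δ ≠ 0 ∧ ¬ ((5 : ℤ) ∣ Literature.NumberTheory.Automorphic.frobTraceAt E v)) → ∃ (hcpt : Literature.NumberTheory.Automorphic.isCompact_glFiniteIntegralLevel 2 F) (π : Literature.NumberTheory.Automorphic.CuspidalAutomorphicRepData 2 F hcpt), π.1.IsLAlgebraic ∧ ∀ᶠ w in cofinite, ∃ α : Multiset ℂ, π.1.HasSatakeParamAt w α ∧ (α.map fun a => a⁻¹).sum =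 (Literature.NumberTheory.Automorphic.frobTraceAt E w : ℂ) ∧ (α.map fun a => a⁻¹).prod = (w.residueCard : ℂ)

/-- item stmt-Langlands-14468 · support · rank 9 · closed · proved by Summit.Langlands.Langlands.Theorems.skinnerWilesDefectOne_modularOfProModularClassical_proof @ eba589e1b6d9 (prover) · by planner
sources: SkinnerWiles1999, planner Sketch.lean modularOfProModularClassical_sketch_holds (lean check rc 0, 2026-08-16)
[support] GLUE TO THE TARGET (frame: cruxes → X; does not drive staffing): X₁ → X₂ → X, i.e.
ReducibleOrdinaryProModular → ProModularOrdinaryClassical → ReducibleOrdinaryModular. Pure logic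
over the item signatures, PROVABLE NOW (8 lines, the body of the deciding theorem `closes`): fix X's
binders (F, p, O, hcpt, ι, ρ, ρ₀) and hypotheses; the engine ReducibleOrdinaryProModular yields a
tame level 𝒰 with `𝒰.IsPadicallyAutomorphic ρ`; from X's local clause at v ∣ p drop
`IsPDistinguishedAt` and the orientation inequality ‖Q₀₀‖ ≤ ‖Q₁₀‖ and repackage the frame Q as
`ρ.IsOrdinaryOfWeightAt p v k m` via
`Literature.NumberTheory.GaloisRepresentations.FramedGaloisRep.isOrdinaryOfWeightAt_iff_padicAlgCl p
ρ v k m` (.mpr ⟨Q, hQ⟩); the exit ProModularOrdinaryClassical then yields the L-algebraic cuspidal π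
with cofinite `SatakeFrobCompatibleAt`. Checked: planner Sketch.lean
`modularOfProModularClassical_sketch_holds` (lean check rc 0, 0 sorries, 2026-08-16) and `example
(hG : …) (h₁) (h₂) (hC : SectorComplement) : Langlands := hC (hG h₁ h₂)`. Filed (badge repair
2026-08-16, route.target-unreachable) so that an item concludes the target ReducibleOrdinaryModular
BY NAME; the seed EisensteinProM -/
@[route_item "route-Langlands-SkinnerWilesDefectOne"]
def ModularOfProModularClassical : Prop :=
  ReducibleOrdinaryProModular → ProModularOrdinaryClassical → ReducibleOrdinaryModular

/-- item stmt-Langlands-14718 · support · rank 9 · open · by planner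
[support] GLUE SEED → ENGINE (route-repair 2026-08-16, glue.unused-crux: connects the rank-3 crux
EisensteinProModularSeed to the `closes` hypothesis ReducibleOrdinaryProModular; does not drive
staffing). Statement: `EisensteinProModularSeed → ReducibleOrdinaryProModular` — Skinner–Wiles' Main
Theorem at defect one GIVEN their step (II): if every admissible residually-reducible
oriented-ordinary pair (ρ, ρ₀) over an imaginary quadratic F admits a level-controlled irreducible
ordinary pro-modular lift r with the same ordered residual diagonal (the seed, = one pro-modular
point of the R_𝒟-type problem for some extension class), then every admissible ρ is p-adically
automorphic of some tame level (the engine). Content = SW steps (I)+(III) run over Λ_F =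
𝒪[[T₁,T₂,Y₁,Y₂]] with l₀ = 1: (III) the reducible locus of R_𝒟 = NearlyOrdinaryDeformationRing has
dim ≤ 3 while every irreducible component has dim ≥ 4 = dim Λ_F − l₀, so each component carries good
dimension-one primes, and SW Prop. 4.2 transport of extension classes + Raynaud connectivity
(SkinnerWiles1999 §§4.1–4.4) make a nice prime on it pro-modular starting from the ONE pro-modular
point the seed supplies (the seed may be invoke -/
@[route_item "route-Langlands-SkinnerWilesDefectOne", crux]
def ProModularOfEisensteinSeed : Prop :=
  EisensteinProModularSeed → ReducibleOrdinaryProModular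

/-- item stmt-Langlands-15158 · support · rank 9 · open · by planner
[support] GLUE BC → SEED (route-choice repair 2026-08-16; does not drive staffing): the seed crux
GIVEN Langlands' quadratic base change, i.e. the picked line descend-raise-basechange run with its
stub S4 discharged from the crux QuadraticBaseChangeGalois (certificate: planner Sketch.lean
`stub_quadraticBaseChangeTwist_of_crux`, rc 0) — content = the line's kernel-checked composition
`EisensteinProModularSeed_of` with its remaining stubs (S0 distinguishedDescendsQ, S1'
inertSupplyPrimeSq, S2' eisensteinPackageQ, S5 cuspidalCohomologicalPoint = dictionary D1, S6'
genuineRegimeSeed = the open heart). Trivially implied by EisensteinProModularSeed itself (`fun h _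
=> h`, Sketch.lean `seedOfQuadraticBaseChange_of_seed`). Filed so that the promoted crux reaches the
deciding theorem: QuadraticBaseChangeGalois → EisensteinProModularSeed →
(ProModularOfEisensteinSeed) ReducibleOrdinaryProModular → closes. [deps: QuadraticBaseChangeGalois,
EisensteinProModularSeed] [difficulty: = the seed] -/
@[route_item "route-Langlands-SkinnerWilesDefectOne"]
def SeedOfQuadraticBaseChange : Prop :=
  QuadraticBaseChangeGalois → EisensteinProModularSeed

/-- item stmt-Langlands-15195 · support · rank 9 · open · by planner
[support] REWIRE BC-APEX → BC-CRUX (route-choice repair 2026-08-16, gen 1; does not drive staffing):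
the base-change crux QuadraticBaseChangeGalois GIVEN Arthur–Clozel strong lifting, i.e.
`StrongLiftingAllFinite → QuadraticBaseChangeGalois`. Content = the landed certificate of the crux
re-run with strong lifting discharged from the ITEM StrongLiftingAllFinite instead of the Literature
constant: (a) at the places w ∤ p of the quadratic field above primes where π is UNRAMIFIED,
`quadraticBaseChangeGalois_goodPrimes_of_facts h₁ h₂ h h27`
(Theorems/SkinnerWilesDefectOneQuadraticBaseChangeGalois.lean; planner Sketch.lean feeds it `h :
StrongLiftingAllFinite`, rc 0), whose remaining cited inputs are (1) cuspidality of the weak lift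
(`baseChange_cyclic_cuspidal`, AC89 Ch. 3 Thm 4.2 (a) — the gen-0 promoted debt, the content of
QuadraticBaseChangeGalois itself), (2) `ArthurClozel1989_strongLifting_archimedean` (Thm 5.1 at ∞ +
Ch. 1 §7: infinity type T ↦ T.baseChange) and lang.S27 `exists_galoisRep_of_regularAlgebraic` over ℚ
(a.e. ⇒ every unramified ℓ ∤ p; = the item IrreducibilityBySelfDuality.GaloisRepOfRegularAlgebraic);
(b) at the finitely many w ∤ p above primes RAMIFIED for π where -/
@[route_item "route-Langlands-SkinnerWilesDefectOne"]
def QuadraticBaseChangeGaloisOfStrongLifting : Prop :=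
  StrongLiftingAllFinite → QuadraticBaseChangeGalois

/-- item stmt-Langlands-15365 · support · rank 9 · open · by planner
[support] GLUE BIANCHI-FINITENESS → EXIT (route-choice repair 2026-08-16 on the exit's line file
Cruxes/ProModularOrdinaryClassical/Lines/top_degree_exact_control; does not drive staffing; clean
re-filing of stmt-Langlands-15746, which the gate blocked on the then-missing decl of crux #7 and
keeps blocked — to be dropped by the tenure planner): the exit crux ProModularOrdinaryClassical
GIVEN Bianchi finiteness, i.e. `BianchiCongruenceCohomologyFinite → ProModularOrdinaryClassical` =
the picked line top_degree_exact_control (lead's skeleton rev 6) run with its fact-stub 3a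
`stub_fact_borelSerreCongruence` discharged from the ITEM BianchiCongruenceCohomologyFinite (crux
#7, stmt-Langlands-15362) instead of the all-n Literature constant (rewiring certificate: planner
Sketch.lean `hidaCohomology_finite_of_bianchi`, rc 0 — stub 3 `stub_hidaCohomology_finite` at
imaginary quadratic F follows from the item by the in-tree Shapiro reduction over the finitely many
components); the remaining content is the line's other stubs (open core
stub_ordinaryFactorisationIwahoriNonCM = (OF) Galois-ordinary ⇒ Hecke-ordinary, the CM stubs
stub_cmInducedCuspidal / stub_cmSatakeFrobGlue, fact-stubs 1d and -/
@[route_item "route-Langlands-SkinnerWilesDefectOne"]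
def ProModularOrdinaryClassicalGivenBianchiFiniteness : Prop :=
  ∀ (_ : BianchiCongruenceCohomologyFinite), ProModularOrdinaryClassical

/-- item stmt-Langlands-12924 · assembly · rank 1 · closed · proved by Summit.Langlands.Langlands.Theorems.skinnerWilesDefectOne_assembly_proof @ 4d19212e9a4d (prover) · by planner
sources: SkinnerWiles1999
[assembly] ReducibleOrdinaryProModular → ProModularOrdinaryClassical → SectorComplement → Langlands
(the deciding theorem `closes` has exactly these three hypotheses; glue.lean proves it with
`target_of`). -/
@[route_item "route-Langlands-SkinnerWilesDefectOne"]
def Assembly : Prop :=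
  ReducibleOrdinaryProModular → ProModularOrdinaryClassical → SectorComplement → _root_.Langlands

-- records of items no longer active in this route (dropped / restated):
-- earlier Assembly2 (stmt-Langlands-15711, dropped 2026-08-17T16:48:31Z): proved by Summit.Langlands.Langlands.Theorems.assembly2_proof @ a6da26ce95c1 — ∀ (K : Type) [Field K] [NumberField K], NumberField.IsTotallyComplex K → Module.finrank ℚ K = 2 → ∀ (U : Subgroup (Literature.NumberTheory.Automorphic.BigHeckeGLn.FiniteAdelicGL 2 K)), IsOpen (U : Set (Literature.NumberTheory.Automorphic.BigHeckeGLn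

/-! D-0027 §2.1 — DECIDING THEOREM (planner-authored via `route open/edit --closes-file`; by planner-rbadge-Langlands-SkinnerWilesDefectOne-dd49536c-g4-0 2026-08-17T16:48:47Z):
its hypotheses are this route's items and its conclusion the sub-problem Statement (glue_lint), and it elaborates with this file. -/

@[closes "route-Langlands-SkinnerWilesDefectOne"] theorem closes (h₁ : ReducibleOrdinaryProModular) (h₂ : ProModularOrdinaryClassical)
    (hC : SectorComplement) : _root_.Langlands := by
  -- engine (h₁) + exit (h₂) assemble the attacked conjunct `ReducibleOrdinaryModular` (target X; the
  -- same 8 lines as the PROVED support item `ModularOfProModularClassical`, p83517); the declared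
  -- RESIDUAL `SectorComplement` (hC := X → Langlands, imported complement, never staffed) carries X
  -- to the summit constant. Tribunal round-1 re-entry (T1′ conjunct residue): attacked = X via
  -- engine ∧ exit; residual = SectorComplement. Proof term unchanged since g2 (2026-08-16).
  refine hC ?_
  intro F _ _ hF hdeg p _ hp O hO hcpt ι ρ ρ₀ hirr hunr hmod hloc
  refine h₂ F hF hdeg p hp hcpt ι ρ hirr hunr (h₁ F hF hdeg p hp O hO ρ ρ₀ hirr hunr hmod hloc) ?_
  obtain ⟨k, hk, m, hm, hv⟩ := hloc
  refine ⟨k, hk, m, hm, fun v hpv => ?_⟩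
  obtain ⟨-, Q, -, hQ⟩ := hv v hpv
  exact (Literature.NumberTheory.GaloisRepresentations.FramedGaloisRep.isOrdinaryOfWeightAt_iff_padicAlgCl p ρ v k m).mpr ⟨Q, hQ⟩

end Summit.Langlands.Langlands.Theses.SkinnerWilesDefectOne
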